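import Mathlib.Analysis.Distribution.SchwartzSpace.Fourier
import Literature.Analysis.FluidPDE.TaoAveragedEuler
import HarnessLib

/-!
# The Leray projector fixes divergence-free Schwartz fields (discharge)

Proof file for the named fact `Literature.Analysis.FluidPDE.lerayProjFun_eq_self_of_isDivFree` of
`Literature/Analysis/FluidPDE/TaoAveragedEuler.lean`: for a divergence-free Schwartz field `u` on
`ℝ^ι` the function-level Leray projector `lerayProjFun` (`P u = Re 𝓕⁻ (P̂ û)`,
`P̂(ξ) c = c − (ξ·c/|ξ|²) ξ`) satisfies `P u = u`.

Source: P. G. Lemarié-Rieusset, *Recent developments in the Navier–Stokes problem* (2002),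
Ch. 11 (the Leray projector as the Fourier multiplier `I − ξ ⊗ ξ/|ξ|²`); the statement is printed
verbatim in P. G. Lemarié-Rieusset, *The Navier–Stokes problem in the 21st century* (2016), §6.3,
remark after Def. 6.4 (held, read): "if `F₀ ∈ 𝒮'`, then if `div F₀ = 0`, we have `ℙ(F₀) = F₀`".

The textbook argument, on the Fourier side: for a Schwartz field `u`,
`𝓕(∂ₖ u)(ξ) = 2πi ξₖ û(ξ)` (Mathlib `SchwartzMap.fourier_lineDerivOp_eq`), so summing the `k`-th
coordinates gives `2πi ∑ₖ ξₖ ûₖ(ξ) = 𝓕(div u)(ξ) = 0`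
(`LerayDivFree.sum_coord_mul_fourierVec_eq_zero`); hence the Leray symbol fixes `û(ξ)` for
every `ξ` (`LerayDivFree.leraySymbolC_fourierVec`), and `P u = Re 𝓕⁻ û = u` by Fourier inversion
for continuous integrable functions with integrable transform (Mathlib
`Continuous.fourierInv_fourier_eq`; `û` is Schwartz, hence integrable,
`LerayDivFree.integrable_fourierVec`). The result holds for every finite index type `ι` (for
empty `ι` all sums are empty and `ℝ^ι` is a point).

This file only adds theorems (no definitions); the complexified Schwartz field is Mathlib's
`SchwartzMap.postcompCLM` of the accepted isometry `FunctionSpaces.EuclideanSpace.complexify`.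

## References

* P. G. Lemarié-Rieusset, *Recent developments in the Navier–Stokes problem*, Chapman &
  Hall/CRC Research Notes in Mathematics 431 (2002), Ch. 11. Key `LemarieRieusset2002`.
* P. G. Lemarié-Rieusset, *The Navier–Stokes problem in the 21st century*, CRC Press (2016),
  §6.3, Def. 6.4 and the remark following it. Key `LemarieRieusset2016`.
-/

noncomputable section

open MeasureTheory FourierTransform
open scoped InnerProductSpace RealInnerProductSpace SchwartzMap LineDeriv

namespace Literature.Analysis.FluidPDE

variable {ι : Type*} [Fintype ι]

namespace LerayDivFree

/-- Coordinates commute with the Fourier integral of an integrable `ℂ^ι`-valued field. [folklore] -/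
theorem fourier_apply_coord {F : EuclideanSpace ℝ ι → EuclideanSpace ℂ ι} (hF : Integrable F)
    (x : EuclideanSpace ℝ ι) (j : ι) : 𝓕 F x j = 𝓕 (fun v => F v j) x := by
  rw [Real.fourier_eq, Real.fourier_eq]
  have h := (EuclideanSpace.proj j : EuclideanSpace ℂ ι →L[ℂ] ℂ).integral_comp_comm
    ((Real.fourierIntegral_convergent_iff x).2 hF)
  simp only [PiLp.proj_apply] at h
  rw [← h]
  simp [Circle.smul_def]

/-- Finite sums commute with the Fourier integral (integrable summands). [folklore] -/
theorem fourier_finset_sum {κ : Type*} (s : Finset κ) {F : κ → EuclideanSpace ℝ ι → ℂ}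
    (hF : ∀ k ∈ s, Integrable (F k)) (x : EuclideanSpace ℝ ι) :
    𝓕 (fun v => ∑ k ∈ s, F k v) x = ∑ k ∈ s, 𝓕 (F k) x := by
  simp only [Real.fourier_eq, Finset.smul_sum]
  rw [integral_finsetSum]
  exact fun k hk => (Real.fourierIntegral_convergent_iff x).2 (hF k hk)

/-- **Fourier side of `div u = 0`**: for a divergence-free Schwartz field `u`,
`∑ₖ ξₖ ûₖ(ξ) = 0` for every frequency `ξ` (`𝓕(∂ₖ u)(ξ) = 2πi ξₖ û(ξ)` summed over `k` equals
`𝓕(div u)(ξ) = 0`; Lemarié-Rieusset 2016, §6.3).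
[cite: LemarieRieusset2016, §6.3 Def. 6.4 and remark] -/
theorem sum_coord_mul_fourierVec_eq_zero {u : EuclideanSpace ℝ ι → EuclideanSpace ℝ ι}
    (hu : IsSchwartzField u) (hdiv : VectorCalculus.IsDivFree u) (ξ : EuclideanSpace ℝ ι) :
    ∑ k, (ξ k : ℂ) * fourierVec u ξ k = 0 := by
  classical
  obtain ⟨g, rfl⟩ := hu
  -- the complexified field `uℂ = complexify ∘ u`, as a Schwartz map `ℝ^ι → ℂ^ι`
  set sC : 𝓢(EuclideanSpace ℝ ι, EuclideanSpace ℂ ι) := SchwartzMap.postcompCLM (𝕜 := ℝ)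
    (FunctionSpaces.EuclideanSpace.complexify (ι := ι)).toContinuousLinearMap g
  have hcoe : ⇑sC = FunctionSpaces.EuclideanSpace.complexify ∘ ⇑g := rfl
  -- the complexified divergence, a sum of coordinates of Schwartz maps, vanishes identically
  have hdiv' : ∀ v : EuclideanSpace ℝ ι,
      ∑ k : ι, (∂_{EuclideanSpace.single k (1 : ℝ)} sC) v k = 0 := by
    intro v
    have hfd : fderiv ℝ (⇑sC) v =
        (FunctionSpaces.EuclideanSpace.complexify (ι := ι)).toContinuousLinearMap.comp
          (fderiv ℝ ⇑g v) :=
      ((FunctionSpaces.EuclideanSpace.complexify (ι := ι)).toContinuousLinearMap.hasFDerivAt.comp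
        v (g.differentiableAt.hasFDerivAt)).fderiv
    simp only [SchwartzMap.lineDerivOp_apply_eq_fderiv, hfd, ContinuousLinearMap.coe_comp,
      Function.comp_apply, LinearIsometry.coe_toContinuousLinearMap,
      FunctionSpaces.EuclideanSpace.complexify_apply]
    rw [← Complex.ofReal_sum, Complex.ofReal_eq_zero]
    have h := hdiv v
    rw [divergence_eq_sum_inner_fderiv (EuclideanSpace.basisFun ι ℝ)] at h
    simpa [EuclideanSpace.basisFun_apply, EuclideanSpace.inner_single_left] using h
  -- temperate growth of the linear symbols `ξ ↦ ⟪ξ, eₖ⟫ = ξₖ`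
  have hg : ∀ k : ι, (fun x : EuclideanSpace ℝ ι =>
      inner ℝ x (EuclideanSpace.single k (1 : ℝ))).HasTemperateGrowth :=
    fun k => ((innerSL ℝ).flip (EuclideanSpace.single k (1 : ℝ))).hasTemperateGrowth
  -- `∑ₖ 𝓕(∂ₖ uℂ)ₖ(ξ) = 2πi ∑ₖ ξₖ ûₖ(ξ)`
  have hF : ∑ k : ι, (𝓕 (∂_{EuclideanSpace.single k (1 : ℝ)} sC) :
      𝓢(EuclideanSpace ℝ ι, EuclideanSpace ℂ ι)) ξ k =
      (2 * Real.pi * Complex.I) * ∑ k, (ξ k : ℂ) * fourierVec (⇑g) ξ k := by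
    simp only [SchwartzMap.fourier_lineDerivOp_eq, _root_.smul_apply,
      SchwartzMap.smulLeftCLM_apply_apply (hg _)]
    simp only [EuclideanSpace.inner_single_right, one_mul, conj_trivial, PiLp.smul_apply,
      smul_eq_mul, Finset.mul_sum, SchwartzMap.fourier_coe, hcoe, Complex.real_smul, fourierVec]
  -- `∑ₖ 𝓕(∂ₖ uℂ)ₖ(ξ) = 𝓕(div u)(ξ) = 0`
  have hF0 : ∑ k : ι, (𝓕 (∂_{EuclideanSpace.single k (1 : ℝ)} sC) :
      𝓢(EuclideanSpace ℝ ι, EuclideanSpace ℂ ι)) ξ k = 0 := by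
    -- the coordinates of the derivative fields, as scalar functions
    let D : ι → EuclideanSpace ℝ ι → ℂ := fun k v => (∂_{EuclideanSpace.single k (1 : ℝ)} sC) v k
    have hDi : ∀ k : ι, Integrable (D k) := fun k =>
      (EuclideanSpace.proj k : EuclideanSpace ℂ ι →L[ℂ] ℂ).integrable_comp
        ((∂_{EuclideanSpace.single k (1 : ℝ)} sC).integrable (μ := volume))
    have h1 : ∀ k : ι, (𝓕 (∂_{EuclideanSpace.single k (1 : ℝ)} sC) :
        𝓢(EuclideanSpace ℝ ι, EuclideanSpace ℂ ι)) ξ k = 𝓕 (D k) ξ := fun k => by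
      rw [SchwartzMap.fourier_coe]
      exact fourier_apply_coord (∂_{EuclideanSpace.single k (1 : ℝ)} sC).integrable ξ k
    have h2 := fourier_finset_sum Finset.univ (F := D) (fun k _ => hDi k) ξ
    have h3 : (fun v : EuclideanSpace ℝ ι => ∑ k : ι, D k v) = fun _ => (0 : ℂ) :=
      funext fun v => hdiv' v
    have h4 : 𝓕 (fun _ : EuclideanSpace ℝ ι => (0 : ℂ)) ξ = 0 := by
      simp [Real.fourier_eq]
    calc ∑ k : ι, (𝓕 (∂_{EuclideanSpace.single k (1 : ℝ)} sC) :
          𝓢(EuclideanSpace ℝ ι, EuclideanSpace ℂ ι)) ξ k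
        = ∑ k : ι, 𝓕 (D k) ξ := Finset.sum_congr rfl fun k _ => h1 k
      _ = 𝓕 (fun v : EuclideanSpace ℝ ι => ∑ k : ι, D k v) ξ := h2.symm
      _ = 0 := by rw [h3, h4]
  rw [hF0] at hF
  have h2pi : (2 * Real.pi * Complex.I : ℂ) ≠ 0 := by
    simp [Real.pi_ne_zero, Complex.I_ne_zero]
  exact (mul_eq_zero.mp hF.symm).resolve_left h2pi

/-- On a divergence-free Schwartz field the Leray symbol acts trivially on the Fourier side:
`P̂(ξ) û(ξ) = û(ξ)` for every `ξ`. [cite: LemarieRieusset2016, §6.3 Def. 6.4 and remark] -/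
theorem leraySymbolC_fourierVec {u : EuclideanSpace ℝ ι → EuclideanSpace ℝ ι}
    (hu : IsSchwartzField u) (hdiv : VectorCalculus.IsDivFree u) (ξ : EuclideanSpace ℝ ι) :
    leraySymbolC ξ (fourierVec u ξ) = fourierVec u ξ := by
  rw [leraySymbolC, sum_coord_mul_fourierVec_eq_zero hu hdiv ξ, zero_div, zero_smul, sub_zero]

/-- The Fourier transform of a Schwartz field is integrable (it is again Schwartz). [folklore] -/
theorem integrable_fourierVec {u : EuclideanSpace ℝ ι → EuclideanSpace ℝ ι}
    (hu : IsSchwartzField u) : Integrable (fourierVec u) := by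
  obtain ⟨g, rfl⟩ := hu
  exact (𝓕 (SchwartzMap.postcompCLM (𝕜 := ℝ)
    (FunctionSpaces.EuclideanSpace.complexify (ι := ι)).toContinuousLinearMap g) :
      𝓢(EuclideanSpace ℝ ι, EuclideanSpace ℂ ι)).integrable (μ := volume)

end LerayDivFree

/-- **Discharge of `lerayProjFun_eq_self_of_isDivFree`**: `P u = u` for every divergence-free
Schwartz field `u` (Lemarié-Rieusset 2002, Ch. 11; printed verbatim in Lemarié-Rieusset 2016,
§6.3, remark after Def. 6.4: "if `F₀ ∈ 𝒮'`, then if `div F₀ = 0`, we have `ℙ(F₀) = F₀`").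
Proof: on the Fourier side `ξ · û(ξ) = 0` (`LerayDivFree.sum_coord_mul_fourierVec_eq_zero`), so
the Leray symbol fixes `û(ξ)`, and Fourier inversion (`Continuous.fourierInv_fourier_eq`)
returns `u`. [cite: LemarieRieusset2002, Ch. 11] -/
theorem lerayProjFun_eq_self_of_isDivFree_holds :
    lerayProjFun_eq_self_of_isDivFree (ι := ι) := by
  intro u hu hdiv
  have hsym : (fun ξ => leraySymbolC ξ (fourierVec u ξ)) = fourierVec u :=
    funext fun ξ => LerayDivFree.leraySymbolC_fourierVec hu hdiv ξ
  have hF : Integrable (fourierVec u) := LerayDivFree.integrable_fourierVec hu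
  obtain ⟨g, rfl⟩ := hu
  have hc : Continuous (FunctionSpaces.EuclideanSpace.complexify ∘ ⇑g) :=
    FunctionSpaces.EuclideanSpace.continuous_complexify.comp g.continuous
  have hci : Integrable (FunctionSpaces.EuclideanSpace.complexify ∘ ⇑g) :=
    FunctionSpaces.EuclideanSpace.complexify.toContinuousLinearMap.integrable_comp
      (g.integrable (μ := volume))
  have h := hc.fourierInv_fourier_eq hci hF
  funext x
  simp only [lerayProjFun, hsym]
  change realPart (𝓕⁻ (𝓕 (FunctionSpaces.EuclideanSpace.complexify ∘ ⇑g)) x) = g x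
  rw [h, Function.comp_apply, realPart_complexify]

end Literature.Analysis.FluidPDE

/-!
# Cancellation for the Euler bilinear operator: discharge of `hasCancellation_eulerBilinear`

Second discharge kept in this leaf file: the named fact
`Literature.Analysis.FluidPDE.hasCancellation_eulerBilinear` of `TaoAveragedEuler.lean` — for every
Schwartz, divergence-free vector field `u : ℝ^ι → ℝ^ι`, `∫ ⟪B(u,u)(x), u(x)⟫ dx = 0` for the
(function-level) Euler bilinear operator `B(u,v) = -½ P[(u·∇)v + (v·∇)u]` (Tao 2016, §1: "the
important cancellation law `⟨B(u,u), u⟩ = 0` … as can be seen by a routine integration by parts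
exploiting the divergence-free nature of `u`"; eq. (1.2) in the numbering of arXiv:1402.0290
(2015 version); Tao adds that the Fourier-side divergence-free condition `û(ξ) ∈ ξ^⊥` "provides
an alternate way to establish" it).

## Proof

Write `w = 2 (u·∇)u`, so `B(u,u) = -½ P w` with `P w = Re 𝓕⁻[P̂(ξ) 𝓕(c ∘ w)(ξ)]`,
`c = complexify`, `P̂(ξ) a = a − (ξ·a/|ξ|²) ξ` (`lerayProjFun`, `leraySymbolC`). Both halves of
Tao's remark are needed, because the file's Leray projector is a genuine Fourier multiplier:
* **Fourier side** (`integral_inner_lerayProjFun_eq`): `∫ ⟪P w, u⟫ = ∫ ⟪w, u⟫` for Schwartz `w`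
  and Schwartz divergence-free `u`: `⟪Re z, v⟫_ℝ = Re ⟪c v, z⟫_ℂ`; the sesquilinear
  multiplication formula (Mathlib `VectorFourier.integral_sesq_fourierIntegral_eq_neg_flip`,
  for the merely integrable `G = P̂ · 𝓕(c∘w)`, `‖G‖ ≤ 2‖𝓕(c∘w)‖`) gives
  `∫ ⟪c u, 𝓕⁻ G⟫ = ∫ ⟪𝓕(c u), G⟫`; the Fourier-side divergence-free condition
  `∑ᵢ ξᵢ 𝓕(c u)ᵢ(ξ) = 0` (`LerayDivFree.sum_coord_mul_fourierVec_eq_zero` above) kills the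
  rank-one part of the symmetric symbol `P̂(ξ)`, so `⟪𝓕(c u), G⟫ = ⟪𝓕(c u), 𝓕(c w)⟫`;
  Plancherel for Schwartz maps (Mathlib `SchwartzMap.integral_sesq_fourier_fourier`) returns to
  `∫ ⟪c u, c w⟫ = ∫ ⟪u, w⟫`.
* **Physical side** (`integral_inner_convect_self_eq_zero_of_schwartz`): the energy identity
  `∫ ⟪(u·∇)u, u⟫ = 0` for Schwartz divergence-free `u`: `⟪Du(x)[u(x)], u(x)⟫ = ½ ∑ᵢ uᵢ ∂ᵢ|u|²`,
  then integrate by parts coordinatewise (Mathlib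
  `SchwartzMap.integral_mul_lineDerivOp_right_eq_neg_left`): `-½ ∫ (div u) |u|² = 0`. (The
  in-tree `integral_inner_convect_self_eq_zero_holds` covers compactly supported `u` only.)

Everything is over `EuclideanSpace ℝ ι` for an arbitrary `Fintype ι`, as the fact demands; no new
definitions (Schwartz representatives of `uᵢ`, `|u|²`, `(u·∇)u` are written with Mathlib's
`SchwartzMap.postcompCLM`, `SchwartzMap.pairing`, `SchwartzMap.fderivCLM`).

## References

* T. Tao, *Finite time blowup for an averaged three-dimensional Navier–Stokes equation*,
  J. Amer. Math. Soc. 29 (2016), 601–674; arXiv:1402.0290, §1, eq. (1.2) (cancellation law) and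
  the remark after (1.4) (Fourier-side divergence-free condition `û(ξ) ∈ ξ^⊥`). Key `Tao2016`.
* P. G. Lemarié-Rieusset, *Recent developments in the Navier–Stokes problem* (2002), Ch. 11
  (the Leray projector as the symmetric Fourier multiplier `I − ξ ⊗ ξ/|ξ|²`).
-/

namespace Literature.Analysis.FluidPDE

open SchwartzMap
open scoped Real

variable {ι : Type*} [Fintype ι]

/-- Coordinates are inner products with the standard basis: `⟪eᵢ, v⟫ = vᵢ`. [folklore] -/
theorem basisFun_inner_eq (v : EuclideanSpace ℝ ι) (i : ι) :
    ⟪EuclideanSpace.basisFun ι ℝ i, v⟫ = v i := by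
  rw [← OrthonormalBasis.repr_apply_apply, EuclideanSpace.basisFun_repr]

/-- The divergence in standard coordinates: `div u (x) = ∑ᵢ (Du(x) eᵢ)ᵢ = ∑ᵢ ∂ᵢuᵢ(x)`. [folklore] -/
theorem divergence_eq_sum_fderiv_apply (u : EuclideanSpace ℝ ι → EuclideanSpace ℝ ι)
    (x : EuclideanSpace ℝ ι) :
    VectorCalculus.divergence u x = ∑ i, fderiv ℝ u x (EuclideanSpace.basisFun ι ℝ i) i := by
  rw [divergence_eq_sum_inner_fderiv (EuclideanSpace.basisFun ι ℝ) u x]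
  simp only [basisFun_inner_eq]

/-- Directional derivative of a coordinate `uᵢ = eᵢ* ∘ u` of a Schwartz field (chain rule):
`∂ᵥ uᵢ (x) = (Du(x) v)ᵢ`. [folklore] -/
theorem lineDerivOp_postcompCLM_proj (f : 𝓢(EuclideanSpace ℝ ι, EuclideanSpace ℝ ι)) (i : ι)
    (v x : EuclideanSpace ℝ ι) :
    ∂_{v} (SchwartzMap.postcompCLM (𝕜 := ℝ) (EuclideanSpace.proj i) f) x = fderiv ℝ f x v i := by
  rw [lineDerivOp_apply_eq_fderiv]
  change fderiv ℝ (⇑(EuclideanSpace.proj (𝕜 := ℝ) i) ∘ ⇑f) x v = _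
  rw [((EuclideanSpace.proj (𝕜 := ℝ) i).hasFDerivAt.comp x (f.hasFDerivAt x)).fderiv]
  rfl

/-- Directional derivative of `|u|² = ⟪u, u⟫` for a Schwartz field:
`∂ᵥ |u|² (x) = 2 ⟪u(x), Du(x) v⟫` (product rule, Mathlib `HasFDerivAt.inner`). [folklore] -/
theorem lineDerivOp_pairing_innerSL_self (f : 𝓢(EuclideanSpace ℝ ι, EuclideanSpace ℝ ι))
    (v x : EuclideanSpace ℝ ι) :
    ∂_{v} (pairing (innerSL ℝ) f f) x = 2 * ⟪f x, fderiv ℝ f x v⟫ := by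
  rw [lineDerivOp_apply_eq_fderiv]
  have h := (f.hasFDerivAt x).inner ℝ (f.hasFDerivAt x)
  change fderiv ℝ (fun y => ⟪f y, f y⟫) x v = _
  rw [h.fderiv]
  simp only [ContinuousLinearMap.comp_apply, ContinuousLinearMap.prod_apply, fderivInnerCLM_apply]
  rw [real_inner_comm (f x)]
  ring

/-- The product of two real Schwartz functions is integrable (it is the Schwartz function
`SchwartzMap.pairing (mul ℝ ℝ) g h`). [folklore] -/
theorem integrable_mul_schwartz (g h : 𝓢(EuclideanSpace ℝ ι, ℝ)) :
    Integrable (fun x => g x * h x) (volume : Measure (EuclideanSpace ℝ ι)) := by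
  have hp := (pairing (ContinuousLinearMap.mul ℝ ℝ) g h).integrable (μ := volume)
  rw [pairing_apply] at hp
  simpa using hp

/-- **Energy identity** `∫ ⟪(u·∇)u, u⟫ = 0` for a Schwartz divergence-free field `u` on `ℝ^ι`
(Tao 2016, §1: "routine integration by parts exploiting the divergence-free nature of `u`";
Majda–Bertozzi, §1.7, Lemma 1.5 with `q = ½|u|²`). Proof: `⟪Du(x)[u(x)], u(x)⟫ = ½ ∑ᵢ uᵢ ∂ᵢ|u|²`
(expand `u(x) = ∑ᵢ uᵢ eᵢ`), then `∫ uᵢ ∂ᵢ|u|² = -∫ (∂ᵢuᵢ) |u|²` for each `i` (Schwartz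
integration by parts, Mathlib `SchwartzMap.integral_mul_lineDerivOp_right_eq_neg_left`) and
`∑ᵢ ∂ᵢuᵢ = 0`.
[cite: Tao2016, §1 eq. (1.2) (arXiv 1402.0290, 2015 version): cancellation law, by parts] -/
theorem integral_inner_convect_self_eq_zero_of_schwartz
    (f : 𝓢(EuclideanSpace ℝ ι, EuclideanSpace ℝ ι))
    (hdiv : VectorCalculus.IsDivFree (f : EuclideanSpace ℝ ι → EuclideanSpace ℝ ι)) :
    ∫ x, ⟪convect f f x, f x⟫ = 0 := by
  have hlin : ∀ x, fderiv ℝ f x (f x) =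
      ∑ i, (f x i) • fderiv ℝ f x (EuclideanSpace.basisFun ι ℝ i) := by
    intro x
    conv_lhs => rw [← (EuclideanSpace.basisFun ι ℝ).sum_repr' (f x)]
    simp only [map_sum, map_smul, basisFun_inner_eq]
  -- pointwise: `⟪Du[u], u⟫ = ½ ∑ᵢ uᵢ ∂ᵢ|u|²`
  have hpt : ∀ x, ⟪convect f f x, f x⟫ =
      2⁻¹ * ∑ i, SchwartzMap.postcompCLM (𝕜 := ℝ) (EuclideanSpace.proj i) f x *
        ∂_{EuclideanSpace.basisFun ι ℝ i} (pairing (innerSL ℝ) f f) x := by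
    intro x
    rw [convect_apply, real_inner_comm (f x), hlin x, inner_sum, Finset.mul_sum]
    refine Finset.sum_congr rfl fun i _ => ?_
    rw [real_inner_smul_right, lineDerivOp_pairing_innerSL_self]
    change f x i * _ = 2⁻¹ * (f x i * _)
    ring
  have hI : ∀ i, Integrable (fun x => SchwartzMap.postcompCLM (𝕜 := ℝ) (EuclideanSpace.proj i) f x *
      ∂_{EuclideanSpace.basisFun ι ℝ i} (pairing (innerSL ℝ) f f) x)
      (volume : Measure (EuclideanSpace ℝ ι)) := fun i => integrable_mul_schwartz _ _
  have hI' : ∀ i, Integrable (fun x => ∂_{EuclideanSpace.basisFun ι ℝ i}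
      (SchwartzMap.postcompCLM (𝕜 := ℝ) (EuclideanSpace.proj i) f) x * pairing (innerSL ℝ) f f x)
      (volume : Measure (EuclideanSpace ℝ ι)) := fun i => integrable_mul_schwartz _ _
  have hsum : ∀ x, ∑ i, ∂_{EuclideanSpace.basisFun ι ℝ i}
      (SchwartzMap.postcompCLM (𝕜 := ℝ) (EuclideanSpace.proj i) f) x = 0 := by
    intro x
    simp only [lineDerivOp_postcompCLM_proj, ← divergence_eq_sum_fderiv_apply]
    exact hdiv x
  calc ∫ x, ⟪convect f f x, f x⟫
      = ∫ x, 2⁻¹ * ∑ i, SchwartzMap.postcompCLM (𝕜 := ℝ) (EuclideanSpace.proj i) f x *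
          ∂_{EuclideanSpace.basisFun ι ℝ i} (pairing (innerSL ℝ) f f) x := by
        simp_rw [hpt]
    _ = 2⁻¹ * ∑ i, ∫ x, SchwartzMap.postcompCLM (𝕜 := ℝ) (EuclideanSpace.proj i) f x *
          ∂_{EuclideanSpace.basisFun ι ℝ i} (pairing (innerSL ℝ) f f) x := by
        rw [integral_const_mul, integral_finsetSum _ fun i _ => hI i]
    _ = 2⁻¹ * ∑ i, -∫ x, ∂_{EuclideanSpace.basisFun ι ℝ i} (SchwartzMap.postcompCLM (𝕜 := ℝ)
          (EuclideanSpace.proj i) f) x * pairing (innerSL ℝ) f f x := by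
        congr 1
        refine Finset.sum_congr rfl fun i _ => ?_
        exact integral_mul_lineDerivOp_right_eq_neg_left _ _ _
    _ = -(2⁻¹ * ∫ x, (∑ i, ∂_{EuclideanSpace.basisFun ι ℝ i} (SchwartzMap.postcompCLM (𝕜 := ℝ)
          (EuclideanSpace.proj i) f) x) * pairing (innerSL ℝ) f f x) := by
        rw [Finset.sum_neg_distrib, ← integral_finsetSum _ fun i _ => hI' i, mul_neg]
        congr 2
        refine integral_congr_ae (Filter.Eventually.of_forall fun x => ?_)
        simp only [Finset.sum_mul]
    _ = 0 := by simp [hsum]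

/-- Real part versus complexification under the inner product:
`⟪Re z, v⟫_ℝ = Re ⟪c v, z⟫_ℂ` for `z ∈ ℂ^ι`, `v ∈ ℝ^ι`. [folklore] -/
theorem inner_realPart_eq_re_inner (z : EuclideanSpace ℂ ι) (v : EuclideanSpace ℝ ι) :
    ⟪realPart z, v⟫ = RCLike.re ⟪FunctionSpaces.EuclideanSpace.complexify v, z⟫_ℂ := by
  simp [PiLp.inner_apply, mul_comm]

/-- The Leray symbol `P̂(ξ) = I − ξ ⊗ ξ/|ξ|²` is symmetric and fixes `ξ^⊥`: if `ξ · a = 0` then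
`⟪a, P̂(ξ) c⟫ = ⟪a, c⟫` for all `c` (Lemarié-Rieusset 2002, Ch. 11; also at the junk value
`ξ = 0`, where `P̂(0) = I`). [folklore] -/
theorem inner_leraySymbolC_eq_of_sum_eq_zero (ξ : EuclideanSpace ℝ ι) (a c : EuclideanSpace ℂ ι)
    (ha : ∑ i, (ξ i : ℂ) * a i = 0) : ⟪a, leraySymbolC ξ c⟫_ℂ = ⟪a, c⟫_ℂ := by
  have h : ⟪a, FunctionSpaces.EuclideanSpace.complexify ξ⟫_ℂ = 0 := by
    have := congrArg (starRingEnd ℂ) ha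
    simpa [PiLp.inner_apply, mul_comm] using this
  simp [leraySymbolC, inner_sub_right, inner_smul_right, h]

/-- The Leray symbol is bounded: `‖P̂(ξ) c‖ ≤ 2‖c‖` (Cauchy–Schwarz for `ξ · c`; the sharp bound
`‖c‖` is not needed). [folklore] -/
theorem norm_leraySymbolC_le (ξ : EuclideanSpace ℝ ι) (c : EuclideanSpace ℂ ι) :
    ‖leraySymbolC ξ c‖ ≤ 2 * ‖c‖ := by
  have hdot : ‖∑ i, (ξ i : ℂ) * c i‖ ≤ ‖ξ‖ * ‖c‖ := by
    have : ∑ i, (ξ i : ℂ) * c i = ⟪FunctionSpaces.EuclideanSpace.complexify ξ, c⟫_ℂ := by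
      simp [PiLp.inner_apply, mul_comm]
    rw [this, ← FunctionSpaces.EuclideanSpace.norm_complexify ξ]
    exact norm_inner_le_norm _ _
  unfold leraySymbolC
  refine (norm_sub_le _ _).trans ?_
  rw [two_mul]
  gcongr
  rw [norm_smul, norm_div, FunctionSpaces.EuclideanSpace.norm_complexify]
  by_cases hξ : ξ = 0
  · simp [hξ]
  · have hn : 0 < ‖ξ‖ := norm_pos_iff.mpr hξ
    have h2 : ‖((‖ξ‖ ^ 2 : ℝ) : ℂ)‖ = ‖ξ‖ ^ 2 := by
      rw [Complex.norm_real, Real.norm_eq_abs, abs_of_nonneg (by positivity)]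
    rw [h2]
    calc ‖∑ i, (ξ i : ℂ) * c i‖ / ‖ξ‖ ^ 2 * ‖ξ‖ ≤ ‖ξ‖ * ‖c‖ / ‖ξ‖ ^ 2 * ‖ξ‖ := by gcongr
      _ = ‖c‖ := by field_simp

/-- `ξ ↦ P̂(ξ) g(ξ)` is measurable for continuous `g`. [folklore] -/
theorem measurable_leraySymbolC_comp {g : EuclideanSpace ℝ ι → EuclideanSpace ℂ ι}
    (hg : Continuous g) : Measurable (fun ξ => leraySymbolC ξ (g ξ)) := by
  unfold leraySymbolC
  have h1 : Continuous fun ξ : EuclideanSpace ℝ ι => ∑ i, (ξ i : ℂ) * g ξ i := by fun_prop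
  have h2 : Continuous fun ξ : EuclideanSpace ℝ ι => ((‖ξ‖ ^ 2 : ℝ) : ℂ) := by fun_prop
  exact hg.measurable.sub ((h1.measurable.div h2.measurable).smul
    FunctionSpaces.EuclideanSpace.continuous_complexify.measurable)

/-- `x ↦ ⟪F(x), 𝓕⁻G(x)⟫` is integrable for `F` continuous integrable and `G` integrable: `𝓕⁻ G`
is continuous (Mathlib `VectorFourier.fourierIntegral_continuous`) and bounded by `∫ ‖G‖`.
[folklore] -/
theorem integrable_inner_fourierInv {F G : EuclideanSpace ℝ ι → EuclideanSpace ℂ ι}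
    (hF : Integrable F) (hFc : Continuous F) (hG : Integrable G) :
    Integrable (fun x => ⟪F x, 𝓕⁻ G x⟫_ℂ) := by
  have hGc : Continuous (𝓕⁻ G) := by
    change Continuous fun w =>
      VectorFourier.fourierIntegral 𝐞 volume (-innerₗ (EuclideanSpace ℝ ι)) G w
    exact VectorFourier.fourierIntegral_continuous Real.continuous_fourierChar
      (by exact continuous_inner.neg) hG
  have hGb : ∀ x, ‖𝓕⁻ G x‖ ≤ ∫ ξ, ‖G ξ‖ := fun x => by
    rw [Real.fourierInv_eq]
    refine (norm_integral_le_integral_norm _).trans (le_of_eq ?_)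
    congr 1 with ξ
    simp
  refine Integrable.mono' (hF.norm.mul_const (∫ ξ, ‖G ξ‖)) (hFc.inner hGc).aestronglyMeasurable ?_
  filter_upwards with x
  exact (norm_inner_le_norm _ _).trans (by gcongr; exact hGb x)

/-- **Duality** `∫ ⟪F, 𝓕⁻ G⟫ = ∫ ⟪𝓕 F, G⟫` for integrable `F`, `G` (Mathlib's sesquilinear
multiplication formula `VectorFourier.integral_sesq_fourierIntegral_eq_neg_flip` with
`M = innerSL ℂ`). [folklore] -/
theorem integral_inner_fourierInv_eq {F G : EuclideanSpace ℝ ι → EuclideanSpace ℂ ι}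
    (hF : Integrable F) (hG : Integrable G) :
    ∫ x, ⟪F x, 𝓕⁻ G x⟫_ℂ = ∫ ξ, ⟪𝓕 F ξ, G ξ⟫_ℂ := by
  have h := VectorFourier.integral_sesq_fourierIntegral_eq_neg_flip (innerSL ℂ)
    (L := innerₗ (EuclideanSpace ℝ ι)) (μ := volume) (ν := volume) Real.continuous_fourierChar
    continuous_inner hF hG
  simp only [flip_innerₗ] at h
  exact h.symm

/-- **`∫ ⟪P w, u⟫ = ∫ ⟪w, u⟫`** for a Schwartz field `w` and a Schwartz divergence-free field `u`
on `ℝ^ι`, where `P = lerayProjFun` is the function-level Leray projector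
`P w = Re 𝓕⁻[P̂ 𝓕(c ∘ w)]` (Lemarié-Rieusset 2002, Ch. 11: `P` is the symmetric multiplier
`I − ξ ⊗ ξ/|ξ|²` and `P u = u` on divergence-free `u`; Tao 2016, §1: `û(ξ) ∈ ξ^⊥`). Proof: see
the module docstring above (duality for the integrable `P̂ 𝓕(c∘w)`, the Fourier-side
divergence-free condition `LerayDivFree.sum_coord_mul_fourierVec_eq_zero`, Plancherel for Schwartz
maps). [folklore] -/
theorem integral_inner_lerayProjFun_eq (f W : 𝓢(EuclideanSpace ℝ ι, EuclideanSpace ℝ ι))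
    (hdiv : VectorCalculus.IsDivFree (f : EuclideanSpace ℝ ι → EuclideanSpace ℝ ι)) :
    ∫ x, ⟪lerayProjFun (⇑W) x, f x⟫ = ∫ x, ⟪W x, f x⟫ := by
  obtain ⟨cf, hcf⟩ : ∃ cf : 𝓢(EuclideanSpace ℝ ι, EuclideanSpace ℂ ι),
      (⇑cf : EuclideanSpace ℝ ι → EuclideanSpace ℂ ι) =
        FunctionSpaces.EuclideanSpace.complexify ∘ ⇑f :=
    ⟨SchwartzMap.postcompCLM (𝕜 := ℝ)
      FunctionSpaces.EuclideanSpace.complexify.toContinuousLinearMap f, rfl⟩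
  obtain ⟨cW, hcW⟩ : ∃ cW : 𝓢(EuclideanSpace ℝ ι, EuclideanSpace ℂ ι),
      (⇑cW : EuclideanSpace ℝ ι → EuclideanSpace ℂ ι) =
        FunctionSpaces.EuclideanSpace.complexify ∘ ⇑W :=
    ⟨SchwartzMap.postcompCLM (𝕜 := ℝ)
      FunctionSpaces.EuclideanSpace.complexify.toContinuousLinearMap W, rfl⟩
  have hFi : Integrable (FunctionSpaces.EuclideanSpace.complexify ∘ ⇑f) := by
    rw [← hcf]; exact cf.integrable
  have hFc : Continuous (FunctionSpaces.EuclideanSpace.complexify ∘ ⇑f) := by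
    rw [← hcf]; exact cf.continuous
  have hFW : fourierVec (⇑W) = 𝓕 (⇑cW) := by rw [hcW]; rfl
  have hcWi : Integrable (𝓕 (⇑cW)) (volume : Measure (EuclideanSpace ℝ ι)) := by
    rw [← SchwartzMap.fourier_coe]; exact (𝓕 cW).integrable
  have hcWc : Continuous (𝓕 (⇑cW)) := by
    rw [← SchwartzMap.fourier_coe]; exact (𝓕 cW).continuous
  -- the multiplier output `G = P̂ · 𝓕(c ∘ w)` is integrable
  have hGi : Integrable (fun ξ => leraySymbolC ξ (fourierVec (⇑W) ξ)) := by
    rw [hFW]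
    refine Integrable.mono' (hcWi.norm.const_mul 2)
      (measurable_leraySymbolC_comp hcWc).aestronglyMeasurable ?_
    exact Filter.Eventually.of_forall fun ξ => norm_leraySymbolC_le ξ _
  calc ∫ x, ⟪lerayProjFun (⇑W) x, f x⟫
      = ∫ x, RCLike.re ⟪(FunctionSpaces.EuclideanSpace.complexify ∘ ⇑f) x,
          𝓕⁻ (fun ξ => leraySymbolC ξ (fourierVec (⇑W) ξ)) x⟫_ℂ :=
        integral_congr_ae (Filter.Eventually.of_forall fun x => inner_realPart_eq_re_inner _ _)
    _ = RCLike.re (∫ x, ⟪(FunctionSpaces.EuclideanSpace.complexify ∘ ⇑f) x,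
          𝓕⁻ (fun ξ => leraySymbolC ξ (fourierVec (⇑W) ξ)) x⟫_ℂ) :=
        integral_re (integrable_inner_fourierInv hFi hFc hGi)
    _ = RCLike.re (∫ ξ, ⟪𝓕 (FunctionSpaces.EuclideanSpace.complexify ∘ ⇑f) ξ,
          leraySymbolC ξ (fourierVec (⇑W) ξ)⟫_ℂ) := by
        rw [integral_inner_fourierInv_eq hFi hGi]
    _ = RCLike.re (∫ ξ, ⟪𝓕 (FunctionSpaces.EuclideanSpace.complexify ∘ ⇑f) ξ,
          fourierVec (⇑W) ξ⟫_ℂ) := by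
        congr 1
        refine integral_congr_ae (Filter.Eventually.of_forall fun ξ => ?_)
        exact inner_leraySymbolC_eq_of_sum_eq_zero ξ _ _
          (LerayDivFree.sum_coord_mul_fourierVec_eq_zero ⟨f, rfl⟩ hdiv ξ)
    _ = RCLike.re (∫ x, ⟪cf x, cW x⟫_ℂ) := by
        rw [hFW, ← hcf]
        have h3 := SchwartzMap.integral_sesq_fourier_fourier cf cW (innerSL ℂ)
        simp only [SchwartzMap.fourier_coe, coe_innerSL_apply] at h3
        rw [h3]
    _ = RCLike.re (∫ x, ((⟪f x, W x⟫ : ℝ) : ℂ)) := by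
        simp only [hcf, hcW, Function.comp_apply, FunctionSpaces.EuclideanSpace.inner_complexify]
    _ = ∫ x, ⟪W x, f x⟫ := by
        rw [integral_complex_ofReal]
        simp only [RCLike.re_to_complex, Complex.ofReal_re]
        exact integral_congr_ae (Filter.Eventually.of_forall fun x => real_inner_comm _ _)

/-- **Discharge** of `hasCancellation_eulerBilinear` (Tao 2016, §1, the cancellation law
`⟨B(u,u), u⟩ = 0` for the Euler bilinear operator `B(u,v) = -½ P[(u·∇)v + (v·∇)u]`, "as can be
seen by a routine integration by parts exploiting the divergence-free nature of `u`"): for every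
Schwartz divergence-free `u : ℝ^ι → ℝ^ι`, `∫ ⟪B(u,u), u⟫ = 0`. Proof:
`∫ ⟪B(u,u), u⟫ = -½ ∫ ⟪P w, u⟫ = -½ ∫ ⟪w, u⟫ = -∫ ⟪(u·∇)u, u⟫ = 0` with `w = 2(u·∇)u`
(`integral_inner_lerayProjFun_eq`, `integral_inner_convect_self_eq_zero_of_schwartz`).
[cite: Tao2016, §1 eq. (1.2) (arXiv 1402.0290, 2015 version): ⟨B(u,u),u⟩ = 0] -/
theorem hasCancellation_eulerBilinear_holds : hasCancellation_eulerBilinear (ι := ι) := by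
  intro u hu hdiv
  obtain ⟨f, rfl⟩ := hu
  -- Schwartz representative of `w = (u·∇)u + (u·∇)u`
  obtain ⟨W, hW⟩ : ∃ W : 𝓢(EuclideanSpace ℝ ι, EuclideanSpace ℝ ι),
      (⇑W : EuclideanSpace ℝ ι → EuclideanSpace ℝ ι) = fun x => convect f f x + convect f f x :=
    ⟨pairing (ContinuousLinearMap.apply ℝ (EuclideanSpace ℝ ι)) f
        (fderivCLM ℝ (EuclideanSpace ℝ ι) (EuclideanSpace ℝ ι) f) +
      pairing (ContinuousLinearMap.apply ℝ (EuclideanSpace ℝ ι)) f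
        (fderivCLM ℝ (EuclideanSpace ℝ ι) (EuclideanSpace ℝ ι) f), rfl⟩
  have h1 : ∀ x, ⟪eulerBilinear (⇑f) (⇑f) x, f x⟫ = -(2 : ℝ)⁻¹ * ⟪lerayProjFun (⇑W) x, f x⟫ := by
    intro x
    rw [eulerBilinear, ← hW, Pi.smul_apply, real_inner_smul_left]
  have h2 : ∀ x, ⟪W x, f x⟫ = 2 * ⟪convect f f x, f x⟫ := by
    intro x
    rw [hW, inner_add_left, two_mul]
  simp_rw [h1]
  rw [integral_const_mul, integral_inner_lerayProjFun_eq f W hdiv]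
  simp_rw [h2]
  rw [integral_const_mul, integral_inner_convect_self_eq_zero_of_schwartz f hdiv, mul_zero,
    mul_zero]

end Literature.Analysis.FluidPDE
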